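import Summits.CriticalPhenomena.PercolationContinuityZ3.Theorems.Transplant.FKConnectivityAllQPat3ShapeTwoK
import Summits.CriticalPhenomena.PercolationContinuityZ3.Theorems.Transplant.FKConnectivityAllQPat3ShapeTwoTab
import HarnessLib

/-!
# Connectivity correlation inequalities for `φ_{w,q}`, every `q > 0` — TABULATED CERTIFICATE CHECKING FOR TWO-PIECE SHAPES WITH
# CONTRACTED SKELETON EDGES (census g41; the kernel-cheap route of census g40's `…Pat3ShapeTwoTab` on `FK.coefTab2K`)

Definitions + theorems file (`--supports stmt-CriticalPhenomena-4575`), census lineage (gen 41) of LANE 2's FK sub-programme; builds on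
p205010 (kernel theorem, internal audit signed; external expert review pending).  No named facts, no sorries; standard axioms.

Census g40's tabulated route (side table literal → coefficient literal → rows, `…Pat3ShapeTwoTab`; cell-wise coefficient check
`…Pat3ShapeTwoCells`) is generic in the side table except for the two facts that tie the literal to the shape; this file supplies them for
the K-state engine `…Pat3ShapeTwoK`: `FK.side2RK`, **`FK.sideCheck2K`** (+ `_spec`), `FK.coefTab2K_eq_coefSide2`, and
**`FK.rows_of_tab2K`** — the rowwise domination `4·Σ λ·tensor ≤ Dn·symm4d (coefTab2K L K …)` that `FK.shape2KC_nonneg_of_rows` consumes,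
from `sideCheck2K`, census g40's `coefCheck2` (or `coefCheck2_of_cells`) and `certCheck2T`.  Users: the VEE\* K-state data files.
[cite: AyyerLinussonRavichandran2025, §7 (p. 22)]
-/

namespace Summit.CriticalPhenomena.PercolationContinuityZ3.Theorems

namespace FK

open SimpleGraph Literature.Probability.LatticeModels Literature.Probability.Percolation
open scoped Classical

variable {V : Type*}

section TabTwoK

variable {ι : Type*} [DecidableEq ι]

/-- The reading of one side of a two-piece shape with contracted skeleton edges: (pattern at the marks, level corrections). [folklore] -/
def side2RK (L K : List (ι × ι)) (i1 j1 k1 i2 j2 k2 ix iy is : ι) (bs : List Bool) (P1 P2 : Pat3) : Pat3 × ℕ :=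
  (rdPat ix iy is (side2K L K i1 j1 k1 i2 j2 k2 bs P1 P2).1, (side2K L K i1 j1 k1 i2 j2 k2 bs P1 P2).2)

/-- **Side-table check (contracted skeleton edges)**: the literal `S` IS the side reading on every colouring and pattern pair. [folklore] -/
def sideCheck2K (L K : List (ι × ι)) (i1 j1 k1 i2 j2 k2 ix iy is : ι) (S : List (List (List (Pat3 × ℕ)))) : Bool :=
  (allBits L.length).all fun bs => Pat3.list.all fun P1 => Pat3.list.all fun P2 =>
    decide (sideGet2 S bs P1 P2 = side2RK L K i1 j1 k1 i2 j2 k2 ix iy is bs P1 P2)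

/-- Unpacking a passed side-table check. [folklore] -/
theorem sideCheck2K_spec {L K : List (ι × ι)} {i1 j1 k1 i2 j2 k2 ix iy is : ι} {S : List (List (List (Pat3 × ℕ)))}
    (h : sideCheck2K L K i1 j1 k1 i2 j2 k2 ix iy is S = true) {bs : List Bool} (hbs : bs.length = L.length) (P1 P2 : Pat3) :
    sideGet2 S bs P1 P2 = side2RK L K i1 j1 k1 i2 j2 k2 ix iy is bs P1 P2 := by
  unfold sideCheck2K at h
  simp only [List.all_eq_true, decide_eq_true_eq] at h
  exact h bs (mem_allBits.2 hbs) P1 P1.mem_list P2 P2.mem_list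

/-- With a correct side table, census g40's `FK.coefSide2` IS `FK.coefTab2K`. [folklore] -/
theorem coefTab2K_eq_coefSide2 {L K : List (ι × ι)} {i1 j1 k1 i2 j2 k2 ix iy is : ι} {S : List (List (List (Pat3 × ℕ)))}
    (h : sideCheck2K L K i1 j1 k1 i2 j2 k2 ix iy is S = true) (F : ℕ → Pat3 → Pat3 → ℤ) (d : ℕ) (P1 Q1 P2 Q2 : Pat3) :
    coefTab2K L K i1 j1 k1 i2 j2 k2 ix iy is F d P1 Q1 P2 Q2 = coefSide2 L.length S F d P1 Q1 P2 Q2 := by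
  unfold coefTab2K coefSide2
  refine sumBits_congr_len L.length fun bs hbs => ?_
  have hbs' : (bs.map (! ·)).length = L.length := by rw [List.length_map, hbs]
  have e1 := sideCheck2K_spec h hbs P1 P2
  have e2 := sideCheck2K_spec h hbs' Q1 Q2
  unfold side2RK at e1 e2
  rw [e1, e2]

/-- **Rows from the three tabulated checks, contracted skeleton edges** (side table, coefficient table up to `B + 4`, rows): the rowwise
domination that `FK.shape2KC_nonneg_of_rows` consumes. [folklore] -/
theorem rows_of_tab2K {L K : List (ι × ι)} {i1 j1 k1 i2 j2 k2 ix iy is : ι} {F : ℕ → Pat3 → Pat3 → ℤ}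
    {S : List (List (List (Pat3 × ℕ)))} {T : List (List (List (List (List ℤ))))} {prods : List Prod2} {Dn B : ℕ}
    (hB : 2 * L.length + 2 * K.length + 2 ≤ B) (hS : sideCheck2K L K i1 j1 k1 i2 j2 k2 ix iy is S = true)
    (hT : coefCheck2 L.length S F T (B + 4) = true) (hc : certCheck2T T prods Dn B = true) (d : ℕ) (P1 Q1 P2 Q2 : Pat3) :
    4 * (prods.map fun q => (q.lam : ℤ) * q.tensor d P1 Q1 P2 Q2).sum ≤
      (Dn : ℤ) * symm4d (coefTab2K L K i1 j1 k1 i2 j2 k2 ix iy is F) d P1 Q1 P2 Q2 := by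
  unfold certCheck2T certRows2T at hc
  rw [Bool.and_eq_true] at hc
  obtain ⟨hshift, hmain⟩ := hc
  simp only [List.all_eq_true, decide_eq_true_eq, Prod2.tensorK_eq] at hshift hmain
  by_cases hd : d < B + 4
  · have e : ∀ A1 A2 A3 A4 : Pat3, coefTab2K L K i1 j1 k1 i2 j2 k2 ix iy is F d A1 A2 A3 A4 = coefGet2 T d A1 A2 A3 A4 :=
      fun A1 A2 A3 A4 => by rw [coefTab2K_eq_coefSide2 hS, coefCheck2_spec hT hd]
    simp only [symm4d, e]
    exact hmain d (List.mem_range.2 hd) P1 P1.mem_list Q1 Q1.mem_list P2 P2.mem_list Q2 Q2.mem_list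
  · rw [not_lt] at hd
    have hz : ∀ A1 A2 A3 A4 : Pat3, coefTab2K L K i1 j1 k1 i2 j2 k2 ix iy is F d A1 A2 A3 A4 = 0 :=
      fun _ _ _ _ => coefTab2K_eq_zero L K i1 j1 k1 i2 j2 k2 ix iy is F (by omega) _ _ _ _
    simp only [symm4d, hz, add_zero, mul_zero]
    refine le_of_eq ?_
    rw [List.sum_eq_zero fun x hx => ?_, mul_zero]
    rw [List.mem_map] at hx
    obtain ⟨q, hq, rfl⟩ := hx
    rw [Prod2.tensor_eq_zero_of_le q (hshift q hq) hd, mul_zero]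

end TabTwoK

end FK

end Summit.CriticalPhenomena.PercolationContinuityZ3.Theorems
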